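import Summits.QuantumAdvantage.AdviceFreeQNC0.CrossTeam
import Summits.QuantumAdvantage.AdviceFreeQNC0.WalkTransport
import HarnessLib

/-!
# Cell qa-qnc0 — `stub_embed`: hardness of the cross-team game gives `RingHardU` (all `n`)

The shared stub `stub_embed : CrossTeamHardPolylog → RingHardU` of both registered lines of the
route crux `RingToElim` (planner qa-qnc0-p1 line `product`, qa-qnc0-p2 line `tensor`), PROVED for
all `n` with both statements' bodies verbatim (`ringHardU_of_crossTeamHard`).

The embedding (trace form of the walk game): for `w = (u, v) ∈ {0,1}^{L} × {0,1}^{L'}` and a walk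
strategy `y = (y_g)_{g ≤ L+L'}`,
  `WIN(w) ⟺ #{g : y_g(w) ∧ c + g + |w| + |w_{<g}| ≢ 0 (3)} odd ⟺ Tr Φ(w) = 1`,
  `Φ(w) = Σ_g y_g(w) ω^{c+g+|w|+|w_{<g}|} = ω^{c+|u|+|v|} · (Λ₀(u,v) + ω^{|u|} Λ₁(u,v))`,
with team 0 holding the positions `g < L` (`Λ₀ = Σ_{g<L} y_g ω^{g+|u_{<g}|}`, `F0`) and team 1 the
positions `g ≥ L` (`Λ₁ = Σ_{g≥L} y_g ω^{g+|v_{<g-L}|}`, `F1`); `Tr(ω^m X) = 1 ⟺ X ∉ {0, ω^{2m}}` is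
exactly the referee `crossWin`. For a fixed own input the other team's coordinates of `Λ_i` are
parities of restrictions of the `y_g`, hence of the same `𝔽₂`-degree (`crossDeg_F0/F1`); the
balanced split `L = ⌊n/2⌋` costs `(log₂ n)^C ≤ (log₂ ⌊n/2⌋)^{2C}` (`n ≥ 8`).

* `ringWinU_append` — the pointwise identity `ringWinU c y (u ++ v) = crossWin c (F0 y) (F1 y) u v`;
* `card_ringWinU_eq` — equal win counts; `crossDeg_F0`, `crossDeg_F1`;
* `ringHardU_of_crossTeamHard` — `stub_embed` (then `stub_embed := fun h =>
  ringHardU_of_crossTeamHard h` against the skeleton's verbatim definitions).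
-/

namespace Summit.QuantumAdvantage.AdviceFreeQNC0

open Finset Literature.Computability.MetaComplexity Literature.Computability.MetaComplexity.Smolensky

variable {L L' : ℕ}

/-! ### Weights of appended words -/

/-- `|u ++ v| = |u| + |v|`. -/
theorem wt_append (u : Fin L → Bool) (v : Fin L' → Bool) : wt (Fin.append u v) = wt u + wt v := by
  unfold wt
  rw [card_filter, card_filter, card_filter, Fin.sum_univ_add]
  simp [Fin.append_left, Fin.append_right]

/-- Prefix weights inside the first block. -/
theorem wtPrefix_append_of_le (u : Fin L → Bool) (v : Fin L' → Bool) {g : ℕ} (hg : g ≤ L) :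
    wtPrefix (Fin.append u v) g = wtPrefix u g := by
  unfold wtPrefix
  rw [card_filter, card_filter, Fin.sum_univ_add]
  have h2 : ∀ j : Fin L', ¬ (L + j.val < g) := fun j => by omega
  rw [Finset.sum_eq_zero (s := (univ : Finset (Fin L'))) (fun j _ => by simp [Fin.append_right, h2 j]),
    add_zero]
  exact Finset.sum_congr rfl fun i _ => by simp [Fin.append_left]

/-- Prefix weights reaching into the second block. -/
theorem wtPrefix_append_of_ge (u : Fin L → Bool) (v : Fin L' → Bool) {g : ℕ} (hg : L ≤ g) :
    wtPrefix (Fin.append u v) g = wt u + wtPrefix v (g - L) := by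
  unfold wtPrefix wt
  rw [card_filter, card_filter, card_filter, Fin.sum_univ_add]
  have h1 : ∀ i : Fin L, i.val < g := fun i => by omega
  have h2 : ∀ j : Fin L', (L + j.val < g ↔ j.val < g - L) := fun j => by omega
  congr 1
  · exact Finset.sum_congr rfl fun i _ => by simp [Fin.append_left, h1 i]
  · exact Finset.sum_congr rfl fun j _ => by simp [Fin.append_right, h2 j]

/-! ### The two teams' profiles -/

/-- Team 0 (positions `g < L`, own input `u`): `Λ₀(u,v) = Σ_{g<L} y_g(u ++ v) ω^{g + |u_{<g}|}`. -/
def F0 (y : Fin (L + L' + 1) → (Fin (L + L') → Bool) → Bool) (u : Fin L → Bool) (v : Fin L' → Bool) : T4 :=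
  t4sum (univ.filter fun g : Fin (L + L' + 1) => g.val < L)
    (fun g => if y g (Fin.append u v) = true then tOmegaPow (g.val + wtPrefix u g.val) (true, false)
      else (false, false))

/-- Team 1 (positions `g ≥ L`, own input `v`): `Λ₁(u,v) = Σ_{g≥L} y_g(u ++ v) ω^{g + |v_{<g-L}|}`. -/
def F1 (y : Fin (L + L' + 1) → (Fin (L + L') → Bool) → Bool) (v : Fin L' → Bool) (u : Fin L → Bool) : T4 :=
  t4sum (univ.filter fun g : Fin (L + L' + 1) => ¬ g.val < L)
    (fun g => if y g (Fin.append u v) = true then tOmegaPow (g.val + wtPrefix v (g.val - L)) (true, false)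
      else (false, false))

/-- `ω^m · (if b then p else 0) = if b then ω^m p else 0`. -/
private theorem tOmegaPow_ite (m : ℕ) (b : Bool) (p : T4) :
    tOmegaPow m (if b = true then p else (false, false)) =
      (if b = true then tOmegaPow m p else (false, false)) := by
  cases b
  · simp [tOmegaPow_zero_elt]
  · simp

/-- **The pointwise identity**: the walk game at `w = u ++ v` is the cross-team referee applied to
the two profiles. -/
theorem ringWinU_append (c : ℕ) (y : Fin (L + L' + 1) → (Fin (L + L') → Bool) → Bool)
    (u : Fin L → Bool) (v : Fin L' → Bool) :
    ringWinU c y (Fin.append u v) = crossWin c (F0 y) (F1 y) u v := by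
  set w := Fin.append u v with hw
  -- trace form: the win bit is the trace of `Φ = Σ_g y_g ω^{c+g+e_g}`
  set T : Fin (L + L' + 1) → T4 := fun g =>
    if y g w = true then tOmegaPow (c + g.val + walkExp w g.val) (true, false) else (false, false) with hT
  have h1 : ringWinU c y w = (t4sum univ T).2 := by
    unfold ringWinU
    rw [t4sum_snd]
    have hset : (univ.filter fun g : Fin (L + L' + 1) =>
          y g w = true ∧ (c + g.val + walkExp w g.val) % 3 ≠ 0) =
        univ.filter fun g : Fin (L + L' + 1) => (T g).2 = true := by
      ext g
      simp only [mem_filter, mem_univ, true_and, hT]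
      cases y g w <;> simp [tOmegaPow_one_snd]
    rw [hset]
  -- factor `ω^{c + |w|}`
  set S : Fin (L + L' + 1) → T4 := fun g =>
    if y g w = true then tOmegaPow (g.val + wtPrefix w g.val) (true, false) else (false, false) with hS
  have h2 : T = fun g => tOmegaPow (c + wt w) (S g) := by
    funext g
    simp only [hT, hS]
    rw [tOmegaPow_ite, ← tOmegaPow_add]
    have he : c + g.val + walkExp w g.val = c + wt w + (g.val + wtPrefix w g.val) := by
      unfold walkExp; ring
    rw [he]
  -- split the positions between the teams
  have h3 : t4sum (univ.filter fun g : Fin (L + L' + 1) => g.val < L) S = F0 y u v := by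
    unfold F0
    refine t4sum_congr _ fun g hg => ?_
    rw [mem_filter] at hg
    simp only [hS, hw, wtPrefix_append_of_le u v hg.2.le]
  have h4 : t4sum (univ.filter fun g : Fin (L + L' + 1) => ¬ g.val < L) S =
      tOmegaPow (wt u) (F1 y v u) := by
    unfold F1
    rw [← t4sum_tOmegaPow]
    refine t4sum_congr _ fun g hg => ?_
    rw [mem_filter] at hg
    simp only [hS, hw, wtPrefix_append_of_ge u v (not_lt.1 hg.2)]
    rw [tOmegaPow_ite, ← tOmegaPow_add]
    have he : g.val + (wt u + wtPrefix v (g.val - L)) = wt u + (g.val + wtPrefix v (g.val - L)) := by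
      ring
    rw [he]
  rw [h1, h2, t4sum_tOmegaPow, t4sum_split univ (fun g : Fin (L + L' + 1) => g.val < L) S, h3, h4,
    hw, wt_append]
  -- the referee
  unfold crossWin
  rw [Bool.eq_iff_iff, win_iff, decide_eq_true_eq, ← add_assoc]

/-! ### Equal win counts -/

/-- **The win sets correspond** under `w ↦ (w|_{<L}, w|_{≥L})`. -/
theorem card_ringWinU_eq (c : ℕ) (y : Fin (L + L' + 1) → (Fin (L + L') → Bool) → Bool) :
    (univ.filter fun w : Fin (L + L') → Bool => ringWinU c y w = true).card =
      crossWinCount c (F0 y) (F1 y) := by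
  unfold crossWinCount
  refine Finset.card_bij' (fun w _ => (fun i => w (Fin.castAdd L' i), fun j => w (Fin.natAdd L j)))
    (fun p _ => Fin.append p.1 p.2) ?_ ?_ ?_ ?_
  · intro w hw
    rw [mem_filter] at hw ⊢
    refine ⟨mem_univ _, ?_⟩
    have := ringWinU_append c y (fun i => w (Fin.castAdd L' i)) (fun j => w (Fin.natAdd L j))
    rw [Fin.append_castAdd_natAdd] at this
    rw [← this]; exact hw.2
  · intro p hp
    rw [mem_filter] at hp ⊢
    exact ⟨mem_univ _, by rw [ringWinU_append]; exact hp.2⟩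
  · intro w _
    exact Fin.append_castAdd_natAdd
  · intro p _
    refine Prod.ext ?_ ?_
    · funext i; simp [Fin.append_left]
    · funext j; simp [Fin.append_right]

/-! ### Cross-degrees of the profiles -/

/-- The constant `1` has every degree. -/
private theorem one_mem_lowDeg'' {k : ℕ} (D : ℕ) : (1 : CubeFn (ZMod 2) k) ∈ lowDeg (ZMod 2) k D := by
  rw [← mono_empty]
  exact mono_mem_lowDeg (by simp)

/-- Indicators of constants have degree `≤ 1`. -/
private theorem ind_const_mem {k : ℕ} (b : Bool) :
    (fun _ : Fin k → Bool => if b = true then (1 : ZMod 2) else 0) ∈ lowDeg (ZMod 2) k 1 := by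
  cases b
  · have : (fun _ : Fin k → Bool => if false = true then (1 : ZMod 2) else 0) = 0 := by
      funext; simp
    rw [this]; exact Submodule.zero_mem _
  · have : (fun _ : Fin k → Bool => if true = true then (1 : ZMod 2) else 0) = 1 := by
      funext; simp
    rw [this]; exact one_mem_lowDeg'' 1

/-- Indicators of variables have degree `≤ 1`. -/
private theorem ind_var_mem {k : ℕ} (j : Fin k) :
    (fun x : Fin k → Bool => if x j = true then (1 : ZMod 2) else 0) ∈ lowDeg (ZMod 2) k 1 := by
  have : (fun x : Fin k → Bool => if x j = true then (1 : ZMod 2) else 0) = mono (ZMod 2) {j} := by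
    funext x; rw [mono_apply]; simp
  rw [this]
  exact mono_mem_lowDeg (by simp)

/-- **Restriction to the second block keeps the degree.** -/
theorem hasDeg_append_right (u : Fin L → Bool) {f : (Fin (L + L') → Bool) → Bool} {D : ℕ}
    (hf : HasDeg f D) : HasDeg (fun v : Fin L' → Bool => f (Fin.append u v)) D := by
  unfold HasDeg at *
  refine comp_mem_lowDeg_of_coord (fun v : Fin L' → Bool => Fin.append u v) (fun i => ?_) hf
  induction i using Fin.addCases with
  | left j => simp only [Fin.append_left]; exact ind_const_mem (u j)
  | right j => simp only [Fin.append_right]; exact ind_var_mem j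

/-- **Restriction to the first block keeps the degree.** -/
theorem hasDeg_append_left (v : Fin L' → Bool) {f : (Fin (L + L') → Bool) → Bool} {D : ℕ}
    (hf : HasDeg f D) : HasDeg (fun u : Fin L → Bool => f (Fin.append u v)) D := by
  unfold HasDeg at *
  refine comp_mem_lowDeg_of_coord (fun u : Fin L → Bool => Fin.append u v) (fun i => ?_) hf
  induction i using Fin.addCases with
  | left j => simp only [Fin.append_left]; exact ind_var_mem j
  | right j => simp only [Fin.append_right]; exact ind_const_mem (v j)

/-- `HasDeg` is monotone in the degree. -/
theorem hasDeg_of_le {k : ℕ} {f : (Fin k → Bool) → Bool} {d d' : ℕ} (h : HasDeg f d) (hdd : d ≤ d') :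
    HasDeg f d' :=
  lowDeg_mono hdd h

/-- A masked Boolean function: `f ∧ b` has the degree of `f`. -/
private theorem hasDeg_and_const {k : ℕ} {f : (Fin k → Bool) → Bool} {D : ℕ} (hf : HasDeg f D)
    (b : Bool) : HasDeg (fun x => f x && b) D := by
  cases b
  · have : (fun x => f x && false) = fun _ : Fin k → Bool => false := by funext x; simp
    rw [this]; exact hasDeg_false D
  · have : (fun x => f x && true) = f := by funext x; simp
    rw [this]; exact hf

/-- The coordinates of a masked `ω`-power term. -/
private theorem ite_tOmegaPow_fst (b : Bool) (m : ℕ) :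
    (if b = true then tOmegaPow m (true, false) else ((false, false) : T4)).1 =
      (b && (tOmegaPow m (true, false)).1) := by
  cases b <;> simp

/-- The second coordinate of a masked `ω`-power term. -/
private theorem ite_tOmegaPow_snd (b : Bool) (m : ℕ) :
    (if b = true then tOmegaPow m (true, false) else ((false, false) : T4)).2 =
      (b && (tOmegaPow m (true, false)).2) := by
  cases b <;> simp

/-- **Team 0's profile has cross-degree `≤ D`.** -/
theorem crossDeg_F0 {D : ℕ} (y : Fin (L + L' + 1) → (Fin (L + L') → Bool) → Bool)
    (hy : ∀ g, HasDeg (y g) D) : CrossDeg D (F0 y) := by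
  intro u
  constructor
  · have heq : (fun v => (F0 y u v).1) = fun v => decide (((univ.filter fun g : Fin (L + L' + 1) =>
        g.val < L).filter fun g => (y g (Fin.append u v) &&
          (tOmegaPow (g.val + wtPrefix u g.val) (true, false)).1) = true).card % 2 = 1) := by
      funext v
      unfold F0 t4sum
      simp only [ite_tOmegaPow_fst]
    rw [heq]
    exact hasDeg_parity _ _ fun g _ => hasDeg_and_const (hasDeg_append_right u (hy g)) _
  · have heq : (fun v => (F0 y u v).2) = fun v => decide (((univ.filter fun g : Fin (L + L' + 1) =>
        g.val < L).filter fun g => (y g (Fin.append u v) &&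
          (tOmegaPow (g.val + wtPrefix u g.val) (true, false)).2) = true).card % 2 = 1) := by
      funext v
      unfold F0 t4sum
      simp only [ite_tOmegaPow_snd]
    rw [heq]
    exact hasDeg_parity _ _ fun g _ => hasDeg_and_const (hasDeg_append_right u (hy g)) _

/-- **Team 1's profile has cross-degree `≤ D`.** -/
theorem crossDeg_F1 {D : ℕ} (y : Fin (L + L' + 1) → (Fin (L + L') → Bool) → Bool)
    (hy : ∀ g, HasDeg (y g) D) : CrossDeg D (F1 y) := by
  intro v
  constructor
  · have heq : (fun u => (F1 y v u).1) = fun u => decide (((univ.filter fun g : Fin (L + L' + 1) =>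
        ¬ g.val < L).filter fun g => (y g (Fin.append u v) &&
          (tOmegaPow (g.val + wtPrefix v (g.val - L)) (true, false)).1) = true).card % 2 = 1) := by
      funext u
      unfold F1 t4sum
      simp only [ite_tOmegaPow_fst]
    rw [heq]
    exact hasDeg_parity _ _ fun g _ => hasDeg_and_const (hasDeg_append_left v (hy g)) _
  · have heq : (fun u => (F1 y v u).2) = fun u => decide (((univ.filter fun g : Fin (L + L' + 1) =>
        ¬ g.val < L).filter fun g => (y g (Fin.append u v) &&
          (tOmegaPow (g.val + wtPrefix v (g.val - L)) (true, false)).2) = true).card % 2 = 1) := by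
      funext u
      unfold F1 t4sum
      simp only [ite_tOmegaPow_snd]
    rw [heq]
    exact hasDeg_parity _ _ fun g _ => hasDeg_and_const (hasDeg_append_left v (hy g)) _

/-! ### The stub -/

/-- Degree bookkeeping for the balanced split: `(log₂ n)^C ≤ (log₂ ⌊n/2⌋)^{2C}` for `n ≥ 8`. -/
private theorem log_pow_le_log_half_pow {n : ℕ} (hn : 8 ≤ n) (C : ℕ) :
    (Nat.log 2 n) ^ C ≤ (Nat.log 2 (n / 2)) ^ (2 * C) := by
  rw [Nat.log_div_base]
  have hx : 3 ≤ Nat.log 2 n := Nat.le_log_of_pow_le (by norm_num) (by omega)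
  obtain ⟨m, hm⟩ : ∃ m, Nat.log 2 n = m + 1 := ⟨Nat.log 2 n - 1, by omega⟩
  rw [hm, Nat.add_sub_cancel]
  have hstep : m + 1 ≤ m ^ 2 := by nlinarith
  calc (m + 1) ^ C ≤ (m ^ 2) ^ C := Nat.pow_le_pow_left hstep C
    _ = m ^ (2 * C) := by rw [← pow_mul]

/-- **`stub_embed`, all `n`: hardness of the cross-team game at polylog cross-degree implies
hardness of the walk game at polylog degree** (bodies of `CrossTeamHardPolylog` and `RingHardU`
verbatim). Split `n = L + L'` with `L = ⌊n/2⌋`; the walk strategy's win set is the cross-team win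
set of the profiles `F0 y`, `F1 y` (`card_ringWinU_eq`), whose cross-degree is the strategy's
degree `(log₂ n)^C ≤ (log₂ min(L,L'))^{2C}`. -/
theorem ringHardU_of_crossTeamHard
    (h : ∃ θ : ℝ, θ < 1 ∧ ∀ C : ℕ, ∃ L₀ : ℕ, ∀ L L' : ℕ, L₀ ≤ L → L₀ ≤ L' →
      ∀ c : ℕ, ∀ F₀ : (Fin L → Bool) → (Fin L' → Bool) → T4,
        ∀ F₁ : (Fin L' → Bool) → (Fin L → Bool) → T4,
          CrossDeg ((Nat.log 2 (min L L')) ^ C) F₀ → CrossDeg ((Nat.log 2 (min L L')) ^ C) F₁ →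
            (crossWinCount c F₀ F₁ : ℝ) ≤ θ * (2 : ℝ) ^ (L + L')) :
    ∃ θ : ℝ, θ < 1 ∧ ∀ C : ℕ, ∃ n₀ : ℕ, ∀ n ≥ n₀, ∀ y : Fin (n + 1) → (Fin n → Bool) → Bool,
      (∀ g, HasDeg (y g) ((Nat.log 2 n) ^ C)) →
        ((univ.filter fun u : Fin n → Bool => ringWinU (n + 2) y u = true).card : ℝ) ≤
          θ * (2 : ℝ) ^ n := by
  obtain ⟨θ, hθ, hCT⟩ := h
  refine ⟨θ, hθ, fun C => ?_⟩
  obtain ⟨L₀, hL₀⟩ := hCT (2 * C)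
  refine ⟨2 * L₀ + 8, fun n hn y hy => ?_⟩
  have hdeg : (Nat.log 2 n) ^ C ≤ (Nat.log 2 (min (n / 2) (n - n / 2))) ^ (2 * C) := by
    rw [min_eq_left (by omega)]
    exact log_pow_le_log_half_pow (by omega) C
  obtain ⟨L, L', hL, hL', hlog, rfl⟩ : ∃ L L' : ℕ, L₀ ≤ L ∧ L₀ ≤ L' ∧
      (Nat.log 2 (L + L')) ^ C ≤ (Nat.log 2 (min L L')) ^ (2 * C) ∧ n = L + L' :=
    ⟨n / 2, n - n / 2, by omega, by omega, by rwa [show n / 2 + (n - n / 2) = n by omega], by omega⟩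
  have hy' : ∀ g, HasDeg (y g) ((Nat.log 2 (min L L')) ^ (2 * C)) := fun g => hasDeg_of_le (hy g) hlog
  have hcount := hL₀ L L' hL hL' (L + L' + 2) (F0 y) (F1 y) (crossDeg_F0 y hy') (crossDeg_F1 y hy')
  rw [card_ringWinU_eq]
  exact hcount

end Summit.QuantumAdvantage.AdviceFreeQNC0
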